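import Summits.Ventures.Crystal3D.Theorems.StickyWulffConstantTextureLiminfTexShadowCoverableDefs
import Summits.Ventures.Crystal3D.Theorems.StickyWulffConstantGenericWallFloorBarlowReversal
import Summits.Ventures.Crystal3D.Theorems.StickyWulffConstantTextureLiminfCellFlux
import Summits.Ventures.Crystal3D.Theorems.StickyWulffConstantTextureLiminfTexShadowLayerFluxDefs
import HarnessLib

/-!
# ZIGZAG OR ROWS: at steepness `√2/2` every plate orientation launches one of the two walker families with flux `≥ 1`
# (lane T, crux `TextureLiminf`, stmt-Ventures-19483; LAYER-FLUX chain, the MAX ruling (xxxvii′) — its payoff)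

HONEST FRAMING. Venture `Summits/Ventures/Crystal3D` (cell `crystal3d-full`), helper `--supports` the crux
`TextureLiminf` (stmt-Ventures-19483) of `route-Ventures-StickyWulffConstant`, registered line `TexShadow`.  Rung credit
only; F-C1 not moved.  Pure trigonometry of the close-packed frame; NOT the wall law, not lane G's row family.

THE DICHOTOMY.  For a plate frame `L` and a unit cut normal `e`, write `ν = L⁻¹e = (ν₀, ν₁, ν₂)`.  The in-layer rows rise by
`layerRise L e = max(|⟪u,ν⟫|, |⟪v,ν⟫|, |⟪u−v,ν⟫|) ≥ (√3/2)·‖(ν₀,ν₁)‖` (six row directions at `60°`: the sharp constant, vs. the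
`1/√2` of `half_lateral_sq_le_layerRise_sq`), and every zigzag step rises by `bilayerRise = M + √(2/3)|ν₂|` with the lateral
maximum `M ≥ ‖(ν₀,ν₁)‖/(2√3)` (`max_lateral_upSlots`).  If the rows are NOT steep (`layerRise < √2/2`) then `‖(ν₀,ν₁)‖² < 2/3`,
`ν₂² > 1/3`, and `M + √(2/3)|ν₂| ≥ √((1−ν₂²)/12) + √(2/3)|ν₂| ≥ √2/2` on `ν₂² ∈ [1/3, 1]` (equality at `ν₂² = 1/3`: the
critical orientation `θ = 54.7°` between two slot azimuths, where both thresholds are met exactly).  Hence: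

* `sqrt_half_le_of_lateral_bound` — the arithmetic core; `exists_lateral_decomp` — `bilayerRise = M + √(2/3)t` with the bounds
  (the case analysis of `quarter_le_bilayerRise`, exposed once);
* `sqrt_half_le_bilayerRise_of_lateral` — `ν₀² + ν₁² ≤ 2/3 ⇒ √2/2 ≤ bilayerRise L σ e i` (every strip, every word, both signs);
* `three_quarters_lateral_le_layerRise_sq` — `(3/4)(ν₀² + ν₁²) ≤ layerRise²` (sharp);
* **`layerRise_or_bilayerRise`** — `√2/2 ≤ layerRise L e ∨ ∀ i, √2/2 ≤ bilayerRise L σ e i`;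
* `deltaSteep_of_lateral`, **`layerSteep_or_deltaSteep`** — in the second case the plate is moreover Δ-STEEP (`DeltaSteep L e`, the
  covered stub's launch condition, via `familySlot_spec` for the up-presentation);
* **`one_le_layerFlux_or_plateFlux`** — flux form at `τ = √2/2`: `1 ≤ layerFlux τ L e ∨ (DeltaSteep L e ∧ ∀ i, 1 ≤ plateFlux τ L σ e i)`.
CONSEQUENCE (stated in `…LineCountGlueMix`): every admissible charge table (`c ≤ 1`) of EVERY plate pair is MIX-dominated at
the corner «rows if steep, else zigzags» per plate — the orientation-deficient remainder of the generic wall part is empty of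
tables once lane G pays one family PAIR per cell (zig|zig is the covered stub; zig|row, row|zig, row|row need the row family's F4).
WHAT THIS IS NOT: not the row family's cap-start / off-reach (lane G); not the on-reach residual; F-C1 not moved.
-/

noncomputable section

namespace Summit.Ventures.Crystal3D.Theorems

open Literature.MathematicalPhysics.StatisticalMechanics (barlowPos_apply_zero barlowPos_apply_one barlowPos_apply_two
  basalMirror basalMirror_apply_coord constHagg)
open Summit.Ventures.Crystal3D.Cruxes.TextureLiminf.TexShadow (E3 e₃ upSlot₁ upSlot₂ upSlot₃ bondRise bilayerRise PlateLaunchable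
  plateFlux layerRise layerFlux upFrame DeltaSteep famSlot inner_layerAxes layerRise_nonneg upFrame_axis_nonneg)
open scoped InnerProductSpace

/-! ## The arithmetic core -/

/-- **Core**: `M ≥ 0`, `t ≥ 0`, `1 − t² ≤ 12M²`, `1/3 ≤ t²` give `√2/2 ≤ M + √(2/3)·t`
(with `p = √(2/3)·(√2/2) = 1/√3`: if `√(2/3)t < √2/2` then `p ≤ t ≤ 3p/2 < 5p/3`, so `9t² − 24pt + 5 = 9(t−p)(t−5p/3) ≤ 0`, i.e.
`12(√2/2 − √(2/3)t)² ≤ 1 − t² ≤ 12M²`). -/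
theorem sqrt_half_le_of_lateral_bound (M t : ℝ) (hM0 : 0 ≤ M) (ht : 0 ≤ t) (hM : 1 - t ^ 2 ≤ 12 * M ^ 2)
    (ht3 : 1 / 3 ≤ t ^ 2) : Real.sqrt 2 / 2 ≤ M + Real.sqrt (2 / 3) * t := by
  have h2 : Real.sqrt 2 ^ 2 = 2 := Real.sq_sqrt (by norm_num)
  have h23 : Real.sqrt (2 / 3) ^ 2 = 2 / 3 := Real.sq_sqrt (by norm_num)
  have hs2 : 0 < Real.sqrt 2 := Real.sqrt_pos.2 (by norm_num)
  have hs23 : 0 < Real.sqrt (2 / 3) := Real.sqrt_pos.2 (by norm_num)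
  set τ : ℝ := Real.sqrt 2 / 2 with hτ
  set η : ℝ := Real.sqrt (2 / 3) with hη
  have hτ2 : τ ^ 2 = 1 / 2 := by rw [hτ, div_pow, h2]; norm_num
  have hτ0 : 0 < τ := by rw [hτ]; positivity
  set p : ℝ := η * τ with hp
  have hp2 : p ^ 2 = 1 / 3 := by rw [hp, mul_pow, h23, hτ2]; norm_num
  have hp0 : 0 < p := mul_pos hs23 hτ0
  by_cases hA : τ ≤ η * t
  · linarith
  push Not at hA
  -- `p ≤ t`: from `t² ≥ 1/3 = p²`
  have htp : p ≤ t := by nlinarith [hp2, ht3, hp0, ht]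
  -- `t ≤ 3p/2`: from `η t < τ`, i.e. `η² t < η τ = p`, `(2/3) t < p`
  have ht32 : t ≤ 3 / 2 * p := by
    have : η * (η * t) ≤ η * τ := (mul_le_mul_of_nonneg_left hA.le hs23.le)
    rw [← mul_assoc, show η * η = η ^ 2 by ring, h23] at this
    rw [hp]; linarith
  have ht53 : t ≤ 5 / 3 * p := by nlinarith [hp0]
  -- the quadratic
  have hquad : 9 * t ^ 2 - 24 * p * t + 5 ≤ 0 := by
    have hprod : 0 ≤ (t - p) * (5 / 3 * p - t) := mul_nonneg (by linarith) (by linarith)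
    nlinarith [hprod, hp2]
  -- `12 A² ≤ 1 − t²` with `A = τ − η t > 0`
  have hA0 : 0 < τ - η * t := by linarith
  have h12 : 12 * (τ - η * t) ^ 2 ≤ 1 - t ^ 2 := by
    have hexp : 12 * (τ - η * t) ^ 2 = 12 * τ ^ 2 - 24 * (η * τ) * t + 12 * η ^ 2 * t ^ 2 := by ring
    rw [hexp, hτ2, h23, ← hp]
    nlinarith [hquad]
  -- hence `A ≤ M`
  have hAM : (τ - η * t) ^ 2 ≤ M ^ 2 := by nlinarith [h12, hM]
  have hAM' : τ - η * t ≤ M := by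
    have := Real.sqrt_le_sqrt hAM
    rwa [Real.sqrt_sq hA0.le, Real.sqrt_sq hM0] at this
  linarith

/-! ## Every zigzag step: `bilayerRise = M + √(2/3)·t` with the lateral bound -/

set_option maxHeartbeats 400000 in
/-- **Lateral decomposition of the zigzag rise** (the case analysis of `quarter_le_bilayerRise`, exposed): for a unit normal,
`bilayerRise L σ e i = M + √(2/3)·t` with `M ≥ 0`, `t = |ν₂| ≥ 0`, `ν₀² + ν₁² + t² = 1` and `ν₀² + ν₁² ≤ 12M²`, `ν = L⁻¹e`. -/
theorem exists_lateral_decomp (L : E3 ≃ₗᵢ[ℝ] E3) (σ : ℤ → ℤ) {e : E3} (he : ‖e‖ = 1) (i : ℤ) :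
    ∃ M t : ℝ, bilayerRise L σ e i = M + Real.sqrt (2 / 3) * t ∧ 0 ≤ M ∧ 0 ≤ t ∧
      (L.symm e) 0 ^ 2 + (L.symm e) 1 ^ 2 + t ^ 2 = 1 ∧ (L.symm e) 0 ^ 2 + (L.symm e) 1 ^ 2 ≤ 12 * M ^ 2 := by
  set ν : E3 := L.symm e with hν
  have hνn : ‖ν‖ = 1 := by rw [hν, LinearIsometryEquiv.norm_map, he]
  have hν2 : ν 0 ^ 2 + ν 1 ^ 2 + ν 2 ^ 2 = 1 := by
    have := EuclideanSpace.norm_sq_eq ν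
    rw [hνn, one_pow, Fin.sum_univ_three] at this
    simp only [Real.norm_eq_abs, sq_abs] at this
    linarith
  -- the three candidate rises, in coordinates
  have hrises : ∀ w : E3, bondRise L σ e i w =
      axisSign L e * (if σ i = 1 then (w 0 * ν 0 + w 1 * ν 1 + w 2 * ν 2) else -(w 0 * ν 0 + w 1 * ν 1 - w 2 * ν 2)) := by
    intro w
    rw [bondRise, axisSign, ← hν]
    congr 1
    split_ifs
    · simp [PiLp.inner_apply, Fin.sum_univ_three, mul_comm]
    · simp [PiLp.inner_apply, Fin.sum_univ_three, basalMirror_apply_coord, mul_comm]; ring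
  have hval : bilayerRise L σ e i = max (max (bondRise L σ e i upSlot₁) (bondRise L σ e i upSlot₂))
      (bondRise L σ e i upSlot₃) := rfl
  -- coordinates of the slots
  have c1 : upSlot₁ 0 = 1 / 2 ∧ upSlot₁ 1 = Real.sqrt 3 / 6 ∧ upSlot₁ 2 = Real.sqrt (2 / 3) := by
    refine ⟨?_, ?_, ?_⟩
    · simp [upSlot₁, barlowPos_apply_zero]
    · simp [upSlot₁, barlowPos_apply_one]; ring
    · simp [upSlot₁, barlowPos_apply_two]
  have c2 : upSlot₂ 0 = -(1 / 2) ∧ upSlot₂ 1 = Real.sqrt 3 / 6 ∧ upSlot₂ 2 = Real.sqrt (2 / 3) := by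
    refine ⟨?_, ?_, ?_⟩ <;> simp [upSlot₂, barlowPos_apply_zero, barlowPos_apply_one, barlowPos_apply_two] <;> ring
  have c3 : upSlot₃ 0 = 0 ∧ upSlot₃ 1 = -(Real.sqrt 3 / 3) ∧ upSlot₃ 2 = Real.sqrt (2 / 3) := by
    refine ⟨?_, ?_, ?_⟩ <;> simp [upSlot₃, barlowPos_apply_zero, barlowPos_apply_one, barlowPos_apply_two] <;> ring
  rw [hval, hrises, hrises, hrises, c1.1, c1.2.1, c1.2.2, c2.1, c2.2.1, c2.2.2, c3.1, c3.2.1, c3.2.2]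
  -- reduce both classes to `|ν₂|√(2/3) + (lateral max at ±ν_lat)`
  unfold axisSign
  by_cases hσ : σ i = 1 <;> simp only [hσ, if_true, if_false] <;> split_ifs with hs
  · -- Δ, sgn = 1
    obtain ⟨hM0, hM⟩ := max_lateral_upSlots (ν 0) (ν 1)
    set M := max (max (ν 0 / 2 + Real.sqrt 3 / 6 * ν 1) (-(ν 0 / 2) + Real.sqrt 3 / 6 * ν 1)) (-(Real.sqrt 3 / 3) * ν 1)
    have hrew : max (max (1 * (1 / 2 * ν 0 + Real.sqrt 3 / 6 * ν 1 + Real.sqrt (2 / 3) * ν 2))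
        (1 * (-(1 / 2) * ν 0 + Real.sqrt 3 / 6 * ν 1 + Real.sqrt (2 / 3) * ν 2)))
        (1 * (0 * ν 0 + -(Real.sqrt 3 / 3) * ν 1 + Real.sqrt (2 / 3) * ν 2)) = M + Real.sqrt (2 / 3) * ν 2 := by
      simp only [one_mul, zero_mul, zero_add]
      rw [show 1 / 2 * ν 0 + Real.sqrt 3 / 6 * ν 1 + Real.sqrt (2 / 3) * ν 2 =
        (ν 0 / 2 + Real.sqrt 3 / 6 * ν 1) + Real.sqrt (2 / 3) * ν 2 by ring,
        show -(1 / 2) * ν 0 + Real.sqrt 3 / 6 * ν 1 + Real.sqrt (2 / 3) * ν 2 =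
        (-(ν 0 / 2) + Real.sqrt 3 / 6 * ν 1) + Real.sqrt (2 / 3) * ν 2 by ring,
        show -(Real.sqrt 3 / 3) * ν 1 + Real.sqrt (2 / 3) * ν 2 = (-(Real.sqrt 3 / 3) * ν 1) + Real.sqrt (2 / 3) * ν 2 by ring,
        max_add_add_right, max_add_add_right]
    rw [hrew]
    have hs' : 0 ≤ ν 2 := by rw [hν]; exact hs
    exact ⟨M, ν 2, rfl, hM0, hs', hν2, hM⟩
  · -- Δ, sgn = -1
    push Not at hs
    obtain ⟨hM0, hM⟩ := max_lateral_upSlots (-ν 0) (-ν 1)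
    set M := max (max (-ν 0 / 2 + Real.sqrt 3 / 6 * -ν 1) (-(-ν 0 / 2) + Real.sqrt 3 / 6 * -ν 1))
      (-(Real.sqrt 3 / 3) * -ν 1)
    have hrew : max (max (-1 * (1 / 2 * ν 0 + Real.sqrt 3 / 6 * ν 1 + Real.sqrt (2 / 3) * ν 2))
        (-1 * (-(1 / 2) * ν 0 + Real.sqrt 3 / 6 * ν 1 + Real.sqrt (2 / 3) * ν 2)))
        (-1 * (0 * ν 0 + -(Real.sqrt 3 / 3) * ν 1 + Real.sqrt (2 / 3) * ν 2)) = M + Real.sqrt (2 / 3) * (-ν 2) := by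
      rw [show -1 * (1 / 2 * ν 0 + Real.sqrt 3 / 6 * ν 1 + Real.sqrt (2 / 3) * ν 2) =
        (-ν 0 / 2 + Real.sqrt 3 / 6 * -ν 1) + Real.sqrt (2 / 3) * (-ν 2) by ring,
        show -1 * (-(1 / 2) * ν 0 + Real.sqrt 3 / 6 * ν 1 + Real.sqrt (2 / 3) * ν 2) =
        (-(-ν 0 / 2) + Real.sqrt 3 / 6 * -ν 1) + Real.sqrt (2 / 3) * (-ν 2) by ring,
        show -1 * (0 * ν 0 + -(Real.sqrt 3 / 3) * ν 1 + Real.sqrt (2 / 3) * ν 2) =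
        (-(Real.sqrt 3 / 3) * -ν 1) + Real.sqrt (2 / 3) * (-ν 2) by ring,
        max_add_add_right, max_add_add_right]
    rw [hrew]
    have hM' : ν 0 ^ 2 + ν 1 ^ 2 ≤ 12 * M ^ 2 := by simpa using hM
    have hs' : 0 ≤ -ν 2 := by rw [hν]; linarith
    exact ⟨M, -ν 2, rfl, hM0, hs', by rw [neg_sq]; exact hν2, hM'⟩
  · -- ∇, sgn = 1
    obtain ⟨hM0, hM⟩ := max_lateral_upSlots (-ν 0) (-ν 1)
    set M := max (max (-ν 0 / 2 + Real.sqrt 3 / 6 * -ν 1) (-(-ν 0 / 2) + Real.sqrt 3 / 6 * -ν 1))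
      (-(Real.sqrt 3 / 3) * -ν 1)
    have hrew : max (max (1 * -(1 / 2 * ν 0 + Real.sqrt 3 / 6 * ν 1 - Real.sqrt (2 / 3) * ν 2))
        (1 * -(-(1 / 2) * ν 0 + Real.sqrt 3 / 6 * ν 1 - Real.sqrt (2 / 3) * ν 2)))
        (1 * -(0 * ν 0 + -(Real.sqrt 3 / 3) * ν 1 - Real.sqrt (2 / 3) * ν 2)) = M + Real.sqrt (2 / 3) * ν 2 := by
      rw [show 1 * -(1 / 2 * ν 0 + Real.sqrt 3 / 6 * ν 1 - Real.sqrt (2 / 3) * ν 2) =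
        (-ν 0 / 2 + Real.sqrt 3 / 6 * -ν 1) + Real.sqrt (2 / 3) * ν 2 by ring,
        show 1 * -(-(1 / 2) * ν 0 + Real.sqrt 3 / 6 * ν 1 - Real.sqrt (2 / 3) * ν 2) =
        (-(-ν 0 / 2) + Real.sqrt 3 / 6 * -ν 1) + Real.sqrt (2 / 3) * ν 2 by ring,
        show 1 * -(0 * ν 0 + -(Real.sqrt 3 / 3) * ν 1 - Real.sqrt (2 / 3) * ν 2) =
        (-(Real.sqrt 3 / 3) * -ν 1) + Real.sqrt (2 / 3) * ν 2 by ring,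
        max_add_add_right, max_add_add_right]
    rw [hrew]
    have hM' : ν 0 ^ 2 + ν 1 ^ 2 ≤ 12 * M ^ 2 := by simpa using hM
    have hs' : 0 ≤ ν 2 := by rw [hν]; exact hs
    exact ⟨M, ν 2, rfl, hM0, hs', hν2, hM'⟩
  · -- ∇, sgn = -1
    push Not at hs
    obtain ⟨hM0, hM⟩ := max_lateral_upSlots (ν 0) (ν 1)
    set M := max (max (ν 0 / 2 + Real.sqrt 3 / 6 * ν 1) (-(ν 0 / 2) + Real.sqrt 3 / 6 * ν 1)) (-(Real.sqrt 3 / 3) * ν 1)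
    have hrew : max (max (-1 * -(1 / 2 * ν 0 + Real.sqrt 3 / 6 * ν 1 - Real.sqrt (2 / 3) * ν 2))
        (-1 * -(-(1 / 2) * ν 0 + Real.sqrt 3 / 6 * ν 1 - Real.sqrt (2 / 3) * ν 2)))
        (-1 * -(0 * ν 0 + -(Real.sqrt 3 / 3) * ν 1 - Real.sqrt (2 / 3) * ν 2)) = M + Real.sqrt (2 / 3) * (-ν 2) := by
      rw [show -1 * -(1 / 2 * ν 0 + Real.sqrt 3 / 6 * ν 1 - Real.sqrt (2 / 3) * ν 2) =
        (ν 0 / 2 + Real.sqrt 3 / 6 * ν 1) + Real.sqrt (2 / 3) * (-ν 2) by ring,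
        show -1 * -(-(1 / 2) * ν 0 + Real.sqrt 3 / 6 * ν 1 - Real.sqrt (2 / 3) * ν 2) =
        (-(ν 0 / 2) + Real.sqrt 3 / 6 * ν 1) + Real.sqrt (2 / 3) * (-ν 2) by ring,
        show -1 * -(0 * ν 0 + -(Real.sqrt 3 / 3) * ν 1 - Real.sqrt (2 / 3) * ν 2) =
        (-(Real.sqrt 3 / 3) * ν 1) + Real.sqrt (2 / 3) * (-ν 2) by ring,
        max_add_add_right, max_add_add_right]
    rw [hrew]
    have hs' : 0 ≤ -ν 2 := by rw [hν]; linarith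
    exact ⟨M, -ν 2, rfl, hM0, hs', by rw [neg_sq]; exact hν2, hM⟩

/-- **Steep zigzags when the normal is within `54.7°` of the plate axis**: `ν₀² + ν₁² ≤ 2/3 ⇒ √2/2 ≤ bilayerRise L σ e i`
(every strip `i`, every word, both signs of `ν₂`). -/
theorem sqrt_half_le_bilayerRise_of_lateral (L : E3 ≃ₗᵢ[ℝ] E3) (σ : ℤ → ℤ) {e : E3} (he : ‖e‖ = 1) (i : ℤ)
    (hlat : (L.symm e) 0 ^ 2 + (L.symm e) 1 ^ 2 ≤ 2 / 3) : Real.sqrt 2 / 2 ≤ bilayerRise L σ e i := by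
  obtain ⟨M, t, hrise, hM0, ht, hsum, hM⟩ := exists_lateral_decomp L σ he i
  rw [hrise]
  exact sqrt_half_le_of_lateral_bound M t hM0 ht (by nlinarith) (by nlinarith)

/-! ## The rows: the sharp lateral bound -/

/-- **`(3/4)(ν₀² + ν₁²) ≤ layerRise²`** (the six row directions are `60°` apart, so one is within `30°` of the lateral part of `ν`;
algebraically `⟪u,ν⟫ = a`, `⟪v,ν⟫ = b`, `⟪u−v,ν⟫ = a − b` and `a² − ab + b² = (3/4)(ν₀² + ν₁²)`). -/
theorem three_quarters_lateral_le_layerRise_sq (L : E3 ≃ₗᵢ[ℝ] E3) (e : E3) :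
    3 / 4 * ((L.symm e) 0 ^ 2 + (L.symm e) 1 ^ 2) ≤ layerRise L e ^ 2 := by
  obtain ⟨h1, h2, h3⟩ := inner_layerAxes (L.symm e)
  have hs3 : Real.sqrt 3 ^ 2 = 3 := Real.sq_sqrt (by norm_num)
  have hr0 : 0 ≤ layerRise L e := layerRise_nonneg L e
  -- the three row rises `a`, `b`, `a - b`
  obtain ⟨a, ha⟩ : ∃ a : ℝ, a = (L.symm e) 0 := ⟨_, rfl⟩
  obtain ⟨b, hb⟩ : ∃ b : ℝ, b = 1 / 2 * (L.symm e) 0 + Real.sqrt 3 / 2 * (L.symm e) 1 := ⟨_, rfl⟩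
  have hra : |a| ≤ layerRise L e := by
    rw [layerRise, h1, ← ha]; exact le_trans (le_max_left _ _) (le_max_left _ _)
  have hrb : |b| ≤ layerRise L e := by
    rw [layerRise, h2, ← hb]; exact le_trans (le_max_right _ _) (le_max_left _ _)
  have hrab : |a - b| ≤ layerRise L e := by
    have : 1 / 2 * (L.symm e) 0 - Real.sqrt 3 / 2 * (L.symm e) 1 = a - b := by rw [ha, hb]; ring
    rw [layerRise, h3, this]; exact le_max_right _ _
  have hkey : 3 / 4 * ((L.symm e) 0 ^ 2 + (L.symm e) 1 ^ 2) = a ^ 2 - a * b + b ^ 2 := by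
    rw [ha, hb]; linear_combination (-(1 : ℝ) / 4 * (L.symm e) 1 ^ 2) * hs3
  rw [hkey]
  have hA0 := abs_nonneg a
  have hB0 := abs_nonneg b
  have ha2 : a ^ 2 = |a| ^ 2 := (sq_abs a).symm
  have hb2 : b ^ 2 = |b| ^ 2 := (sq_abs b).symm
  have hrb2 : |b| ^ 2 ≤ layerRise L e ^ 2 := pow_le_pow_left₀ hB0 hrb 2
  have hra2 : |a| ^ 2 ≤ layerRise L e ^ 2 := pow_le_pow_left₀ hA0 hra 2
  rcases le_or_gt 0 (a * b) with hab | hab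
  · -- same sign: `a² − ab + b² ≤ max(a², b²)`
    have hab' : a * b = |a| * |b| := by rw [← abs_mul, abs_of_nonneg hab]
    rw [ha2, hb2, hab']
    rcases le_total |a| |b| with h | h
    · have : 0 ≤ |a| * (|b| - |a|) := mul_nonneg hA0 (sub_nonneg.2 h)
      nlinarith [this, hrb2]
    · have : 0 ≤ |b| * (|a| - |b|) := mul_nonneg hB0 (sub_nonneg.2 h)
      nlinarith [this, hra2]
  · -- opposite signs: `(a − b)² = a² − 2ab + b² ≥ a² − ab + b²`
    have hab2 : (a - b) ^ 2 ≤ layerRise L e ^ 2 := by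
      rw [← sq_abs (a - b)]; exact pow_le_pow_left₀ (abs_nonneg _) hrab 2
    nlinarith [hab2, hab]

/-! ## The dichotomy -/

/-- **ZIGZAG OR ROWS**: at steepness `√2/2`, either the in-layer rows of the plate are steep, or EVERY zigzag step is. -/
theorem layerRise_or_bilayerRise (L : E3 ≃ₗᵢ[ℝ] E3) (σ : ℤ → ℤ) {e : E3} (he : ‖e‖ = 1) :
    Real.sqrt 2 / 2 ≤ layerRise L e ∨ ∀ i : ℤ, Real.sqrt 2 / 2 ≤ bilayerRise L σ e i := by
  by_cases h : Real.sqrt 2 / 2 ≤ layerRise L e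
  · exact Or.inl h
  · right
    push Not at h
    have h2 : Real.sqrt 2 ^ 2 = 2 := Real.sq_sqrt (by norm_num)
    have hr0 := layerRise_nonneg L e
    have hsq : layerRise L e ^ 2 < 1 / 2 := by
      have hlt : layerRise L e * layerRise L e < Real.sqrt 2 / 2 * (Real.sqrt 2 / 2) :=
        mul_lt_mul'' h h hr0 hr0
      nlinarith [h2]
    have hlat : (L.symm e) 0 ^ 2 + (L.symm e) 1 ^ 2 ≤ 2 / 3 := by
      have := three_quarters_lateral_le_layerRise_sq L e; nlinarith
    exact fun i => sqrt_half_le_bilayerRise_of_lateral L σ he i hlat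

/-- The up-presentation has the same lateral part of the normal. -/
theorem lateral_upFrame (L : E3 ≃ₗᵢ[ℝ] E3) (e : E3) :
    ((upFrame L e).symm e) 0 ^ 2 + ((upFrame L e).symm e) 1 ^ 2 = (L.symm e) 0 ^ 2 + (L.symm e) 1 ^ 2 := by
  unfold upFrame
  split_ifs
  · rfl
  · rw [symm_mirror_trans_apply, basalMirror_apply_coord, basalMirror_apply_coord]
    simp

/-- **Δ-steepness when the normal is within `54.7°` of the axis**: `ν₀² + ν₁² ≤ 2/3 ⇒ DeltaSteep L e` (the family slot of the
up-presentation rises by `bilayerRise ≥ √2/2` on its Δ-bilayers — `familySlot_spec` with the constant word). -/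
theorem deltaSteep_of_lateral (L : E3 ≃ₗᵢ[ℝ] E3) {e : E3} (he : ‖e‖ = 1)
    (hlat : (L.symm e) 0 ^ 2 + (L.symm e) 1 ^ 2 ≤ 2 / 3) : DeltaSteep L e := by
  set L' := upFrame L e with hL'
  have hax : 0 ≤ (L'.symm e) 2 := upFrame_axis_nonneg L e
  obtain ⟨hv, hv2, hspec⟩ := familySlot_spec constHagg L' e (famSlot L e) hax rfl
  obtain ⟨-, hrise⟩ := hspec 0 rfl
  refine ⟨famSlot L e, hv, hv2, ?_⟩
  rw [inner_map_eq_inner_symm, hrise]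
  apply sqrt_half_le_bilayerRise_of_lateral L' constHagg he 0
  rw [hL', lateral_upFrame]; exact hlat

/-- **ROWS STEEP, OR Δ-STEEP WITH STEEP ZIGZAGS** (the form the wall-law split consumes). -/
theorem layerSteep_or_deltaSteep (L : E3 ≃ₗᵢ[ℝ] E3) (σ : ℤ → ℤ) {e : E3} (he : ‖e‖ = 1) :
    Real.sqrt 2 / 2 ≤ layerRise L e ∨ (DeltaSteep L e ∧ ∀ i : ℤ, Real.sqrt 2 / 2 ≤ bilayerRise L σ e i) := by
  by_cases h : Real.sqrt 2 / 2 ≤ layerRise L e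
  · exact Or.inl h
  · right
    push Not at h
    have h2 : Real.sqrt 2 ^ 2 = 2 := Real.sq_sqrt (by norm_num)
    have hr0 := layerRise_nonneg L e
    have hsq : layerRise L e ^ 2 < 1 / 2 := by
      have hlt : layerRise L e * layerRise L e < Real.sqrt 2 / 2 * (Real.sqrt 2 / 2) :=
        mul_lt_mul'' h h hr0 hr0
      nlinarith [h2]
    have hlat : (L.symm e) 0 ^ 2 + (L.symm e) 1 ^ 2 ≤ 2 / 3 := by
      have := three_quarters_lateral_le_layerRise_sq L e; nlinarith
    exact ⟨deltaSteep_of_lateral L he hlat, fun i => sqrt_half_le_bilayerRise_of_lateral L σ he i hlat⟩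

/-- **Flux form at `τ = √2/2`**: either the row flux is `≥ 1`, or the plate is Δ-steep and every strip's zigzag flux is `≥ 1`. -/
theorem one_le_layerFlux_or_plateFlux (L : E3 ≃ₗᵢ[ℝ] E3) (σ : ℤ → ℤ) {e : E3} (he : ‖e‖ = 1) :
    1 ≤ layerFlux (Real.sqrt 2 / 2) L e ∨
      (DeltaSteep L e ∧ ∀ i : ℤ, 1 ≤ plateFlux (Real.sqrt 2 / 2) L σ e i) := by
  have h2 : Real.sqrt 2 ^ 2 = 2 := Real.sq_sqrt (by norm_num)
  have hs2 : 0 < Real.sqrt 2 := Real.sqrt_pos.2 (by norm_num)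
  have hone : Real.sqrt 2 * (Real.sqrt 2 / 2) = 1 := by nlinarith [h2]
  rcases layerSteep_or_deltaSteep L σ he with h | ⟨hΔ, h⟩
  · left
    unfold layerFlux
    rw [if_pos h, ← hone]
    exact mul_le_mul_of_nonneg_left h hs2.le
  · right
    refine ⟨hΔ, fun i => ?_⟩
    have hl : PlateLaunchable (Real.sqrt 2 / 2) L σ e := ⟨0, h 0⟩
    rw [plateFlux, if_pos hl, ← hone]
    exact mul_le_mul_of_nonneg_left (h i) hs2.le

end Summit.Ventures.Crystal3D.Theorems

end
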